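import Literature.ComputerArithmetic.Shewchuk1997.Compress
import Mathlib.Tactic.Linarith
import Mathlib.Tactic.Positivity
import Mathlib.Tactic.Ring
import Mathlib.Tactic.NormNum
import Mathlib.Tactic.FieldSimp

/-!
# The relative error of Shewchuk's staircase: exactly `A/(1 + 2^p·A)`, supremum `2^-p` (new work)

New work of the certified-arithmetic venture (ENGINES group: shared numerical engines serving
client cells; rigour lives in the verifiers; every published number belongs to a client cell's
ledger, not to the engines group).  Line: the error of the largest component of COMPRESS
[Shewchuk1997, §2.7 Theorem 23 and the conjecture on p. 333].

The STAIRCASE `⟨2^e₀, 2^(e₀+p), …, 2^(e₀+kp)⟩` ("1 + ½ulp(1) + ¼ulp(ulp(1)) + ⋯", p. 333) is a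
fixed point of COMPRESS under round-to-nearest-EVEN for every precision `p ≥ 2` and every length
(`CompressStaircaseFixedPoint.lean`), and it attains the sharp ulp-form bound.  THIS FILE computes
its error in the RELATIVE reading `|Σ − hₙ| < 2^-p·|Σ|` exactly — pure algebra, no rounding:

* `staircase_sum_eq_mul_geom` — `Σ = 2^e₀·B_k` with `B_k = Σ_{j≤k} (2^p)^j = 1 + 2^p·A_k`,
  `A_k = Σ_{j<k} (2^p)^j`; `staircase_sum_sub_top` — `Σ − 2^(e₀+kp) = 2^e₀·A_k`.
* `staircase_relative_error_eq` — `|Σ − top| / |Σ| = A_k / (1 + 2^p·A_k)`; hence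
  `staircase_relative_error_lt` — the relative reading HOLDS on every staircase (the same fact, in
  the normalisation `hₙ = 1`, is `every_pth_bit_relative_error_lt` of `CompressRelativeErrorWitness.lean`;
  here it is stated for the staircase LIST of `CompressStaircaseFixedPoint.lean`), with the NEW exact
  gap `staircase_relative_gap`: `2^-p·|Σ| − |Σ − top| = 2^-p·2^e₀` (`2^-p` times the SMALLEST
  component, independent of `k`).
* `staircase_relative_error_sup` (NEW) — for every `δ < 2^-p` some staircase has relative error `> δ`:
  the supremum over the family is exactly `2^-p`, not attained.

Consequence (with `CompressStaircaseFixedPoint.lean`): under round-to-even the constant `2^-p` of the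
relative reading cannot be lowered — the supremum of `|Σ − hₙ|/|Σ|` over COMPRESS outputs is at
least `2^-p` — while these witnesses never reach it.  HONEST FRAMING: whether `2^-p` is ever reached
or exceeded under round-to-even (Shewchuk's conjecture in the relative reading) stays OPEN; under
ties-to-away it is exceeded (`CompressRelativeErrorTiesAway*.lean`).  `p`, `e₀` are parameters.
-/

namespace Summit.Ventures.CertifiedArithmetic.Expansions

/-- List sums over `range` are `Finset` sums. [cite: Shewchuk1997, §2.7 p. 333] -/
private theorem sum_map_range_eq (f : ℕ → ℚ) :
    ∀ k : ℕ, ((List.range k).map f).sum = (Finset.range k).sum f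
  | 0 => by simp
  | k + 1 => by
    rw [List.range_succ, List.map_append, List.sum_append, Finset.sum_range_succ,
      sum_map_range_eq f k]
    simp

/-- The staircase term factors: `2^(e₀ + jp) = 2^e₀·(2^p)^j`. [cite: Shewchuk1997, §2.7 p. 333] -/
private theorem stair_term (p : ℕ) (e₀ : ℤ) (j : ℕ) :
    (2 : ℚ) ^ (e₀ + (j : ℤ) * p) = (2 : ℚ) ^ e₀ * ((2 : ℚ) ^ p) ^ j := by
  rw [zpow_add₀ (by norm_num : (2 : ℚ) ≠ 0),
    show ((j : ℤ) * (p : ℤ)) = ((p * j : ℕ) : ℤ) by push_cast; ring, zpow_natCast, pow_mul]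

/-- `B_k = 1 + 2^p·A_k`: shifting the geometric sum. [cite: Shewchuk1997, §2.7 p. 333] -/
private theorem geom_shift (p k : ℕ) :
    (Finset.range (k + 1)).sum (fun j : ℕ => ((2 : ℚ) ^ p) ^ j) =
      1 + (2 : ℚ) ^ p * (Finset.range k).sum (fun j : ℕ => ((2 : ℚ) ^ p) ^ j) := by
  rw [Finset.sum_range_succ', Finset.mul_sum, pow_zero, add_comm]
  congr 1
  exact Finset.sum_congr rfl fun i _ => by rw [pow_succ]; ring

/-- **The staircase sum**: `Σ_{j≤k} 2^(e₀+jp) = 2^e₀ · Σ_{j≤k} (2^p)^j`.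
[cite: Shewchuk1997, §2.7 p. 333 ("1 + ½ulp(1) + ¼ulp(ulp(1)) + ⋯")] -/
theorem staircase_sum_eq_mul_geom (p : ℕ) (e₀ : ℤ) (k : ℕ) :
    ((List.range (k + 1)).map (fun j : ℕ => (2 : ℚ) ^ (e₀ + (j : ℤ) * p))).sum =
      (2 : ℚ) ^ e₀ * (Finset.range (k + 1)).sum (fun j : ℕ => ((2 : ℚ) ^ p) ^ j) := by
  rw [sum_map_range_eq, Finset.mul_sum]
  exact Finset.sum_congr rfl fun j _ => stair_term p e₀ j

/-- **The error of the top**: `Σ − 2^(e₀+kp) = 2^e₀ · A_k`, `A_k = Σ_{j<k} (2^p)^j` (the sum of the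
lower components). [cite: Shewchuk1997, §2.7 p. 333] -/
theorem staircase_sum_sub_top (p : ℕ) (e₀ : ℤ) (k : ℕ) :
    ((List.range (k + 1)).map (fun j : ℕ => (2 : ℚ) ^ (e₀ + (j : ℤ) * p))).sum
        - (2 : ℚ) ^ (e₀ + (k : ℤ) * p) =
      (2 : ℚ) ^ e₀ * (Finset.range k).sum (fun j : ℕ => ((2 : ℚ) ^ p) ^ j) := by
  rw [List.sum_range_succ, add_sub_cancel_right, sum_map_range_eq, Finset.mul_sum]
  exact Finset.sum_congr rfl fun j _ => stair_term p e₀ j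

/-- **The staircase's relative error, exactly**: `|Σ − top| / |Σ| = A_k / (1 + 2^p·A_k)` with
`A_k = Σ_{j<k} (2^p)^j`. [cite: Shewchuk1997, §2.7 p. 333 (conjecture, relative reading)] -/
theorem staircase_relative_error_eq (p : ℕ) (e₀ : ℤ) (k : ℕ) :
    |((List.range (k + 1)).map (fun j : ℕ => (2 : ℚ) ^ (e₀ + (j : ℤ) * p))).sum
        - (2 : ℚ) ^ (e₀ + (k : ℤ) * p)| /
      |((List.range (k + 1)).map (fun j : ℕ => (2 : ℚ) ^ (e₀ + (j : ℤ) * p))).sum| =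
      (Finset.range k).sum (fun j : ℕ => ((2 : ℚ) ^ p) ^ j) /
        (1 + (2 : ℚ) ^ p * (Finset.range k).sum (fun j : ℕ => ((2 : ℚ) ^ p) ^ j)) := by
  have hA : 0 ≤ (Finset.range k).sum (fun j : ℕ => ((2 : ℚ) ^ p) ^ j) :=
    Finset.sum_nonneg fun j _ => by positivity
  have he : (0 : ℚ) < (2 : ℚ) ^ e₀ := zpow_pos (by norm_num) e₀
  rw [staircase_sum_sub_top, staircase_sum_eq_mul_geom, geom_shift,
    abs_of_nonneg (mul_nonneg he.le hA), abs_of_pos (mul_pos he (by positivity)),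
    mul_div_mul_left _ _ he.ne']

/-- **The relative reading holds on every staircase**: `|Σ − top| < 2^-p·|Σ|` — indeed
`2^e₀·A_k < 2^-p·2^e₀·(1 + 2^p·A_k) = 2^e₀·(2^-p + A_k)`.
[cite: Shewchuk1997, §2.7 p. 333 (conjecture, relative reading)] -/
theorem staircase_relative_error_lt (p : ℕ) (e₀ : ℤ) (k : ℕ) :
    |((List.range (k + 1)).map (fun j : ℕ => (2 : ℚ) ^ (e₀ + (j : ℤ) * p))).sum
        - (2 : ℚ) ^ (e₀ + (k : ℤ) * p)| <
      ((2 : ℚ) ^ p)⁻¹ *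
        |((List.range (k + 1)).map (fun j : ℕ => (2 : ℚ) ^ (e₀ + (j : ℤ) * p))).sum| := by
  have hA : 0 ≤ (Finset.range k).sum (fun j : ℕ => ((2 : ℚ) ^ p) ^ j) :=
    Finset.sum_nonneg fun j _ => by positivity
  have he : (0 : ℚ) < (2 : ℚ) ^ e₀ := zpow_pos (by norm_num) e₀
  have h2 : (0 : ℚ) < (2 : ℚ) ^ p := by positivity
  rw [staircase_sum_sub_top, staircase_sum_eq_mul_geom, geom_shift,
    abs_of_nonneg (mul_nonneg he.le hA), abs_of_pos (mul_pos he (by positivity))]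
  have key : ((2 : ℚ) ^ p)⁻¹ * ((2 : ℚ) ^ e₀ *
      (1 + (2 : ℚ) ^ p * (Finset.range k).sum (fun j : ℕ => ((2 : ℚ) ^ p) ^ j))) =
      (2 : ℚ) ^ e₀ * (Finset.range k).sum (fun j : ℕ => ((2 : ℚ) ^ p) ^ j)
        + ((2 : ℚ) ^ p)⁻¹ * (2 : ℚ) ^ e₀ := by
    field_simp
    ring
  rw [key]
  have : 0 < ((2 : ℚ) ^ p)⁻¹ * (2 : ℚ) ^ e₀ := mul_pos (inv_pos.mpr h2) he
  linarith

/-- **The exact gap**: `2^-p·|Σ| − |Σ − top| = 2^-p·2^e₀` — `2^-p` times the SMALLEST component,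
independent of the length `k`. [cite: Shewchuk1997, §2.7 p. 333 (conjecture, relative reading)] -/
theorem staircase_relative_gap (p : ℕ) (e₀ : ℤ) (k : ℕ) :
    ((2 : ℚ) ^ p)⁻¹ *
        |((List.range (k + 1)).map (fun j : ℕ => (2 : ℚ) ^ (e₀ + (j : ℤ) * p))).sum| -
      |((List.range (k + 1)).map (fun j : ℕ => (2 : ℚ) ^ (e₀ + (j : ℤ) * p))).sum
        - (2 : ℚ) ^ (e₀ + (k : ℤ) * p)| = ((2 : ℚ) ^ p)⁻¹ * (2 : ℚ) ^ e₀ := by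
  have hA : 0 ≤ (Finset.range k).sum (fun j : ℕ => ((2 : ℚ) ^ p) ^ j) :=
    Finset.sum_nonneg fun j _ => by positivity
  have he : (0 : ℚ) < (2 : ℚ) ^ e₀ := zpow_pos (by norm_num) e₀
  have h2 : (0 : ℚ) < (2 : ℚ) ^ p := by positivity
  rw [staircase_sum_sub_top, staircase_sum_eq_mul_geom, geom_shift,
    abs_of_nonneg (mul_nonneg he.le hA), abs_of_pos (mul_pos he (by positivity))]
  field_simp
  ring

/-- **Supremum `2^-p`**: for every `δ < 2^-p` some staircase (same `e₀`, length `k` large) has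
relative error `> δ`, since the gap `2^-p·2^e₀` is fixed while `|Σ| ≥ 2^e₀·(2^p)^k` grows (`p ≥ 1`).
Together with the fixed-point property under round-to-even (`CompressStaircaseFixedPoint.lean`) the
constant `2^-p` of the relative reading cannot be lowered for COMPRESS outputs.
[cite: Shewchuk1997, §2.7 p. 333 (conjecture, relative reading)] -/
theorem staircase_relative_error_sup {p : ℕ} (hp : 1 ≤ p) (e₀ : ℤ) {δ : ℚ}
    (hδ : δ < ((2 : ℚ) ^ p)⁻¹) :
    ∃ k : ℕ, δ * |((List.range (k + 1)).map (fun j : ℕ => (2 : ℚ) ^ (e₀ + (j : ℤ) * p))).sum| <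
      |((List.range (k + 1)).map (fun j : ℕ => (2 : ℚ) ^ (e₀ + (j : ℤ) * p))).sum
        - (2 : ℚ) ^ (e₀ + (k : ℤ) * p)| := by
  have h2 : (1 : ℚ) < (2 : ℚ) ^ p := one_lt_pow₀ (by norm_num) (by omega)
  have h2pos : (0 : ℚ) < (2 : ℚ) ^ p := by positivity
  have he : (0 : ℚ) < (2 : ℚ) ^ e₀ := zpow_pos (by norm_num) e₀
  have hgapδ : 0 < ((2 : ℚ) ^ p)⁻¹ - δ := sub_pos.mpr hδ
  obtain ⟨k, hk⟩ := pow_unbounded_of_one_lt (((2 : ℚ) ^ p)⁻¹ / (((2 : ℚ) ^ p)⁻¹ - δ)) h2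
  refine ⟨k, ?_⟩
  have hgap := staircase_relative_gap p e₀ k
  -- `|Σ| ≥ 2^e₀ · (2^p)^k` (the top alone)
  have hbig : (2 : ℚ) ^ e₀ * ((2 : ℚ) ^ p) ^ k ≤
      |((List.range (k + 1)).map (fun j : ℕ => (2 : ℚ) ^ (e₀ + (j : ℤ) * p))).sum| := by
    rw [staircase_sum_eq_mul_geom,
      abs_of_pos (mul_pos he (Finset.sum_pos (fun j _ => by positivity) (by simp)))]
    refine mul_le_mul_of_nonneg_left ?_ he.le
    exact Finset.single_le_sum (f := fun j : ℕ => ((2 : ℚ) ^ p) ^ j)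
      (fun j _ => by positivity) (Finset.mem_range.mpr (Nat.lt_succ_self k))
  -- from `hk`: `2^-p < (2^-p − δ)·(2^p)^k`
  have hk' : ((2 : ℚ) ^ p)⁻¹ < (((2 : ℚ) ^ p)⁻¹ - δ) * ((2 : ℚ) ^ p) ^ k := by
    have := (div_lt_iff₀ hgapδ).mp hk
    linarith [this]
  have hprod : (((2 : ℚ) ^ p)⁻¹ - δ) * ((2 : ℚ) ^ e₀ * ((2 : ℚ) ^ p) ^ k) ≤
      (((2 : ℚ) ^ p)⁻¹ - δ) *
        |((List.range (k + 1)).map (fun j : ℕ => (2 : ℚ) ^ (e₀ + (j : ℤ) * p))).sum| :=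
    mul_le_mul_of_nonneg_left hbig hgapδ.le
  nlinarith [hgap, hk', hprod, he, mul_pos he hgapδ]

/-- SANITY CHECK of the exact value (an evaluation, not a claim of the paper): `p = 4`, `k = 2`,
`e₀ = 0` — the staircase `⟨1, 16, 256⟩` has `Σ = 273`, `|Σ − 256| = 17`, relative error
`17/273 < 1/16` (`A₂ = 17`, `1 + 16·17 = 273`), gap `273/16 − 17 = 1/16`.
[cite: Shewchuk1997, §2.7 p. 333] -/
example : (17 : ℚ) / 273 < 1 / 16 ∧ (273 : ℚ) / 16 - 17 = 1 / 16 ∧ (1 : ℚ) + 16 * 17 = 273 := by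
  norm_num

end Summit.Ventures.CertifiedArithmetic.Expansions
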